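import Literature.NumberTheory.LFunctions.ExplicitFormulaPsiContour
import HarnessLib

/-!
# Landau's formula `∑_{|γ| ≤ T} x^ρ`: the contour (residues of `(−ζ'/ζ)·Φ` for an entire weight)

Topic: `Literature/NumberTheory/LFunctions`. THEOREMS (everything proved). The complex-analytic
half of the proof of Landau's formula over the zeros of `ζ` (E. Landau, *Über die Nullstellen der
Zetafunktion*, Math. Ann. 71 (1911), 548–564; uniform version S. M. Gonek, *An explicit formula of
Landau and its applications to the theory of the zeta-function*, Contemp. Math. 143 (1993),
395–413, Thm. 1), for a GENERAL ENTIRE WEIGHT `Φ`: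

* `contour_identity_entire` — for `b > 1`, `K ≥ 1`, a gap `δ` for the ordinates and a height
  `T ≥ 1` which is `±` no ordinate of a zero, Cauchy's residue theorem on `[−2K−1/2, b] × [−T, T]`:
  `∮ (−ζ'/ζ)(s) Φ(s) ds = 2πi (Φ(1) − ∑_{|Im ρ| ≤ T} m(ρ) Φ(ρ) − ∑_{k<K} Φ(−2(k+1)))`
  (pole at `1`; the non-trivial zeros `ρ` with multiplicity `m(ρ) = riemannZetaZeroOrder ρ`, summed
  over `weilZeroIndex T`; the simple trivial zeros `−2(k+1)`).

Compared with the tree's contour identity for the Perron kernel `x^s/s`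
(`ExplicitPsi.contour_identity`, `ExplicitFormulaPsiContour.lean`), the weight is entire, so the
weighted argument principle (`Literature.Analysis.Complex.integral_boundary_rect_logDeriv_mul`) is
applied once to `ζ₁ = (s−1)ζ` on the whole rectangle, and the rational piece `Φ(s)/(s−1)` is
Cauchy's formula at `1`; the zero set of `ζ₁` in the open rectangle is
`weilZeroIndex T ∪ {−2(k+1) : k < K}` (`zeroSet_eq`).

## References

* E. Landau, *Über die Nullstellen der Zetafunktion*, Math. Ann. 71 (1911), 548–564. [Landau1911]
* S. M. Gonek, *An explicit formula of Landau and its applications to the theory of the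
  zeta-function*, Contemp. Math. 143 (1993), 395–413, Thm. 1. [Gonek1993]
* H. L. Montgomery, R. C. Vaughan, *Multiplicative Number Theory I*, CUP 2007, §12.1 (method).
  [MontgomeryVaughan2007]
-/

noncomputable section

open Complex Filter Set MeasureTheory Topology intervalIntegral
open scoped Real Interval

namespace Literature.NumberTheory.LFunctions

namespace LandauGonek

open PsiOneExplicit ExplicitPsi

/-! ### The zero set of `ζ₁` in the rectangle -/

/-- The zeros of `ζ₁ = (s−1)ζ(s)` in the open rectangle `(−2K−1/2, b) × (−T, T)` (`b > 1`, `δ` a gap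
for the ordinates, `T` `±` no ordinate): the non-trivial zeros with `|Im ρ| ≤ T` together with the
trivial zeros `−2(k+1)`, `k < K`. [folklore] -/
theorem zeroSet_eq {b δ T : ℝ} (hb : 1 < b) (hδ : 0 < δ)
    (hgap : ∀ ρ ∈ RHWave0.riemannZetaNontrivialZeros, 2 * δ ≤ |ρ.im|) (hT : 0 < T)
    (hgood : ∀ ρ ∈ RHWave0.riemannZetaNontrivialZeros, ρ.im ≠ T ∧ ρ.im ≠ -T) (K : ℕ) :
    {ρ : ℂ | riemannZeta₁ ρ = 0 ∧ ρ ∈ Ioo (-(2 * (K : ℝ)) - 1 / 2) b ×ℂ Ioo (-T) T} =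
      weilZeroIndex T ∪ (fun k : ℕ ↦ (-2 * ((k : ℂ) + 1))) '' ((Finset.range K : Finset ℕ) : Set ℕ) := by
  ext ρ
  simp only [mem_setOf_eq, Complex.mem_reProdIm, mem_Ioo, mem_union, mem_image, Finset.coe_range,
    mem_Iio, weilZeroIndex]
  constructor
  · rintro ⟨h0, ⟨ha, -⟩, hi1, hi2⟩
    have hζ := riemannZeta_eq_zero_of_riemannZeta₁ h0
    by_cases him : ρ.im = 0
    · right
      rcases le_or_gt ρ.re 0 with hre | hre
      · obtain ⟨n, hn⟩ := (riemannZeta_eq_zero_iff_of_re_nonpos hre).1 hζ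
        refine ⟨n, ?_, by rw [hn]⟩
        have h1 := congrArg Complex.re hn
        simp at h1
        rw [h1] at ha
        by_contra hc
        push Not at hc
        have : (K : ℝ) ≤ n := by exact_mod_cast hc
        linarith
      · have hmem := ZetaZeros.riemannZetaNontrivialZeros.mem_of_re_pos hζ hre
        have hg := hgap ρ hmem
        rw [him, abs_zero] at hg
        linarith
    · left
      have hmem := ZetaZeros.riemannZetaNontrivialZeros.mem_of_im_ne_zero hζ him
      exact ⟨hζ, (ZetaZeros.riemannZetaNontrivialZeros.re_pos hmem).le,
        (ZetaZeros.riemannZetaNontrivialZeros.re_lt_one hmem).le, him, abs_le.2 ⟨hi1.le, hi2.le⟩⟩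
  · rintro (⟨hζ, -, -, him, habs⟩ | ⟨n, hn, rfl⟩)
    · have hmem := ZetaZeros.riemannZetaNontrivialZeros.mem_of_im_ne_zero hζ him
      have hρ1 : ρ ≠ 1 := ZetaZeros.riemannZetaNontrivialZeros.ne_one hmem
      have hre0 := ZetaZeros.riemannZetaNontrivialZeros.re_pos hmem
      have hre1 := ZetaZeros.riemannZetaNontrivialZeros.re_lt_one hmem
      obtain ⟨hne1, hne2⟩ := hgood ρ hmem
      have hK0 : (0 : ℝ) ≤ 2 * (K : ℝ) := by positivity
      refine ⟨(riemannZeta₁_eq_zero_iff hρ1).2 hζ, ⟨by linarith, by linarith⟩,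
        lt_of_le_of_ne (abs_le.1 habs).1 (Ne.symm hne2), lt_of_le_of_ne (abs_le.1 habs).2 hne1⟩
    · have hnK : (n : ℝ) + 1 ≤ K := by exact_mod_cast hn
      have hne1 : (-2 * ((n : ℂ) + 1)) ≠ 1 := by
        intro h; have := congrArg Complex.re h; simp at this; linarith [(n.cast_nonneg : (0 : ℝ) ≤ n)]
      refine ⟨(riemannZeta₁_eq_zero_iff hne1).2 ?_, ⟨?_, ?_⟩, ?_, ?_⟩
      · have h := riemannZeta_neg_two_mul_nat_add_one n
        simpa using h
      · simp; linarith
      · simp; linarith [(n.cast_nonneg : (0 : ℝ) ≤ n)]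
      · simp; exact hT
      · simp; exact hT

/-! ### The contour identity -/

/-- The integrand off the zeros: `(−ζ'/ζ)(s) Φ(s) = −(ζ₁'/ζ₁)(s) Φ(s) + Φ(s)/(s−1)`. [folklore] -/
theorem integrand_eq_split {Φ : ℂ → ℂ} {s : ℂ} (hs1 : s ≠ 1) (hζ : riemannZeta s ≠ 0) :
    (-deriv riemannZeta s / riemannZeta s) * Φ s =
      (-1) * (logDeriv riemannZeta₁ s * Φ s) + 1 * (Φ s / (s - 1)) := by
  rw [neg_div, ← logDeriv_apply, logDeriv_riemannZeta_eq hs1 hζ]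
  have h1 : s - 1 ≠ 0 := sub_ne_zero.2 hs1
  field_simp
  ring

/-- The weighted argument principle for `ζ₁` with an entire weight on `[−2K−1/2, b] × [−T, T]`:
`∮ (ζ₁'/ζ₁) Φ = 2πi (∑_{|Im ρ| ≤ T} m(ρ) Φ(ρ) + ∑_{k<K} Φ(−2(k+1)))`. [folklore] -/
theorem rectBoundaryIntegral_logDeriv_riemannZeta₁_mul {Φ : ℂ → ℂ} (hΦ : Differentiable ℂ Φ)
    {b δ T : ℝ} (hb : 1 < b) (hδ : 0 < δ)
    (hgap : ∀ ρ ∈ RHWave0.riemannZetaNontrivialZeros, 2 * δ ≤ |ρ.im|)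
    (hT : 0 < T) (hgood : ∀ ρ ∈ RHWave0.riemannZetaNontrivialZeros, ρ.im ≠ T ∧ ρ.im ≠ -T)
    {K : ℕ} (hK : 1 ≤ K)
    (h_bot : ∀ t ∈ Icc (-(2 * (K : ℝ)) - 1 / 2) b, riemannZeta₁ (t + (-T : ℝ) * I) ≠ 0)
    (h_top : ∀ t ∈ Icc (-(2 * (K : ℝ)) - 1 / 2) b, riemannZeta₁ (t + T * I) ≠ 0)
    (h_left : ∀ y ∈ Icc (-T) T, riemannZeta₁ ((-(2 * (K : ℝ)) - 1 / 2 : ℝ) + y * I) ≠ 0)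
    (h_right : ∀ y ∈ Icc (-T) T, riemannZeta₁ (b + y * I) ≠ 0) :
    Literature.Analysis.Complex.rectBoundaryIntegral
        (fun s ↦ logDeriv riemannZeta₁ s * Φ s) (-(2 * (K : ℝ)) - 1 / 2) b (-T) T =
      2 * π * I * (∑ ρ ∈ (weilZeroIndex_finite T).toFinset, (riemannZetaZeroOrder ρ : ℂ) * Φ ρ +
        ∑ k ∈ Finset.range K, Φ (-2 * ((k : ℂ) + 1))) := by
  have hK1 : (1 : ℝ) ≤ K := by exact_mod_cast hK
  have hab : -(2 * (K : ℝ)) - 1 / 2 < b := by linarith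
  have key := Literature.Analysis.Complex.integral_boundary_rect_logDeriv_mul (f := riemannZeta₁)
    (g := Φ) hab (by linarith : -T < T) (fun z _ ↦ differentiable_riemannZeta₁.analyticAt z)
    (fun z _ ↦ hΦ.analyticAt z) h_bot h_top h_left h_right
  simp only [← logDeriv_apply] at key
  rw [Literature.Analysis.Complex.rectBoundaryIntegral, key]
  congr 1
  -- the zero set
  set Tr : Set ℂ := (fun k : ℕ ↦ (-2 * ((k : ℂ) + 1))) '' ((Finset.range K : Finset ℕ) : Set ℕ)
    with hTr
  have hset := zeroSet_eq hb hδ hgap hT hgood K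
  have hdisj : Disjoint (weilZeroIndex T) Tr := by
    rw [Set.disjoint_left]
    rintro ρ ⟨-, -, -, him, -⟩ ⟨n, -, rfl⟩
    exact him (by simp)
  have hWf := weilZeroIndex_finite T
  have hTrf : Tr.Finite := ((Finset.range K).finite_toSet).image _
  have hinj : Set.InjOn (fun k : ℕ ↦ (-2 * ((k : ℂ) + 1))) ((Finset.range K : Finset ℕ) : Set ℕ) := by
    intro m _ n _ h
    have := congrArg Complex.re h
    simp at this
    exact_mod_cast this
  rw [hset, finsum_mem_union hdisj hWf hTrf, finsum_mem_eq_finite_toFinset_sum _ hWf, hTr,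
    finsum_mem_image hinj, finsum_mem_coe_finset]
  congr 1
  · refine Finset.sum_congr rfl fun ρ hρ ↦ ?_
    rw [Set.Finite.mem_toFinset] at hρ
    have hmem : ρ ∈ RHWave0.riemannZetaNontrivialZeros := by
      rw [weilZeroIndex_eq_inter] at hρ; exact hρ.1
    simp only [riemannZetaZeroOrder]
    rw [meromorphicOrderAt_riemannZeta₁_eq (ZetaZeros.riemannZetaNontrivialZeros.ne_one hmem)]
  · refine Finset.sum_congr rfl fun k _ ↦ ?_
    have hne1 : (-2 * ((k : ℂ) + 1)) ≠ 1 := by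
      intro h; have := congrArg Complex.re h; simp at this
      linarith [(k.cast_nonneg : (0 : ℝ) ≤ k)]
    rw [meromorphicOrderAt_riemannZeta₁_eq hne1,
      show (meromorphicOrderAt riemannZeta (-2 * ((k : ℂ) + 1))).untop₀ =
        riemannZetaZeroOrder (-2 * ((k : ℂ) + 1)) from rfl, riemannZetaZeroOrder_trivialZero k]
    simp

/-- **The contour identity for an entire weight** (Landau 1911 / Gonek 1993, the residue step).
For `Φ` entire, `b > 1`, `K ≥ 1`, a gap `δ` for the ordinates and a height `T ≥ 1` which is `±`
no ordinate of a zero: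
`∮_{∂([−2K−1/2, b] × [−T, T])} (−ζ'/ζ)(s) Φ(s) ds =
  2πi (Φ(1) − ∑_{|Im ρ| ≤ T} m(ρ) Φ(ρ) − ∑_{k<K} Φ(−2(k+1)))`
(residues: the pole of `ζ` at `1`, the non-trivial zeros with multiplicity, the simple trivial
zeros). [cite: Gonek1993, Thm. 1 (proof)] -/
theorem contour_identity_entire {Φ : ℂ → ℂ} (hΦ : Differentiable ℂ Φ) {b δ T : ℝ} (hb : 1 < b)
    (hδ : 0 < δ) (hgap : ∀ ρ ∈ RHWave0.riemannZetaNontrivialZeros, 2 * δ ≤ |ρ.im|)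
    (hT : 1 ≤ T) (hgood : ∀ ρ ∈ RHWave0.riemannZetaNontrivialZeros, ρ.im ≠ T ∧ ρ.im ≠ -T)
    {K : ℕ} (hK : 1 ≤ K) :
    Literature.Analysis.Complex.rectBoundaryIntegral
        (fun s ↦ (-deriv riemannZeta s / riemannZeta s) * Φ s) (-(2 * (K : ℝ)) - 1 / 2) b (-T) T =
      2 * π * I * (Φ 1 -
        ∑ ρ ∈ (weilZeroIndex_finite T).toFinset, (riemannZetaZeroOrder ρ : ℂ) * Φ ρ -
          ∑ k ∈ Finset.range K, Φ (-2 * ((k : ℂ) + 1))) := by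
  have hT0 : (0 : ℝ) < T := by linarith
  have hK1 : (1 : ℝ) ≤ K := by exact_mod_cast hK
  set a : ℝ := -(2 * (K : ℝ)) - 1 / 2 with ha
  have hab : a < b := by rw [ha]; linarith
  have ha0 : a < 0 := by rw [ha]; linarith
  -- `a` is not a trivial-zero abscissa
  have hnot : ∀ n : ℕ, a ≠ -2 * ((n : ℝ) + 1) := by
    intro n h
    have h2 : (4 : ℝ) * ((n : ℝ) + 1 - K) = 1 := by rw [ha] at h; linarith
    have h3 : (4 * ((n : ℤ) + 1 - K) : ℤ) = 1 := by exact_mod_cast h2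
    omega
  -- `ζ ≠ 0` on the horizontal edges
  have hζ_T : ∀ s : ℂ, |s.im| = T → riemannZeta s ≠ 0 := by
    intro s hs h0
    have him : s.im ≠ 0 := fun h ↦ by rw [h, abs_zero] at hs; linarith
    obtain ⟨h1, h2⟩ := hgood s (ZetaZeros.riemannZetaNontrivialZeros.mem_of_im_ne_zero h0 him)
    rcases (abs_eq hT0.le).1 hs with h | h
    · exact h1 h
    · exact h2 h
  -- facts on the boundary
  have hbdry : ∀ z : ℂ, (|z.im| = T ∨ (z.re = b ∨ z.re = a)) →
      riemannZeta z ≠ 0 ∧ z ≠ 1 ∧ riemannZeta₁ z ≠ 0 := by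
    intro z hz
    have key : riemannZeta z ≠ 0 ∧ z ≠ 1 := by
      rcases hz with hz | hz
      · have him : z.im ≠ 0 := fun h ↦ by rw [h, abs_zero] at hz; linarith
        exact ⟨hζ_T z hz, fun h ↦ him (by simp [h])⟩
      · rcases hz with hz | hz
        · refine ⟨riemannZeta_ne_zero_of_one_le_re (by rw [hz]; exact hb.le), fun h ↦ ?_⟩
          rw [h] at hz; simp at hz; linarith
        · refine ⟨riemannZeta_ne_zero_of_re_nonpos (by rw [hz]; exact ha0.le) fun n h ↦ ?_,
            fun h ↦ ?_⟩
          · exact hnot n (by have := congrArg Complex.re h; rw [hz] at this; simpa using this)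
          · rw [h] at hz; simp at hz; linarith
    exact ⟨key.1, key.2, fun h ↦ key.1 ((riemannZeta₁_eq_zero_iff key.2).1 h)⟩
  have him_T : ∀ (t : ℝ) (y : ℝ), (y = -T ∨ y = T) → |((t : ℂ) + y * I).im| = T := by
    intro t y hy; rcases hy with rfl | rfl <;> simp [abs_of_pos hT0]
  have hre_v : ∀ (r : ℝ), (r = b ∨ r = a) → ∀ y : ℝ,
      ((r : ℂ) + y * I).re = b ∨ ((r : ℂ) + y * I).re = a := by
    intro r hr y; rcases hr with rfl | rfl <;> simp
  -- the two pieces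
  set F₁ : ℂ → ℂ := fun s ↦ (-1) * (logDeriv riemannZeta₁ s * Φ s) with hF₁
  set F₂ : ℂ → ℂ := fun s ↦ 1 * (Φ s / (s - 1)) with hF₂
  have hcF₁ : ∀ z : ℂ, riemannZeta₁ z ≠ 0 → ContinuousAt F₁ z := fun z hζ ↦
    continuousAt_const.mul (((analyticAt_logDeriv_riemannZeta₁ hζ).continuousAt).mul
      (hΦ z).continuousAt)
  have hcF₂ : ∀ z : ℂ, z ≠ 1 → ContinuousAt F₂ z := fun z h1 ↦
    continuousAt_const.mul ((hΦ z).continuousAt.div (continuousAt_id.sub continuousAt_const)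
      (sub_ne_zero.2 h1))
  have hbot : ∀ t ∈ Icc a b, |((t : ℂ) + ((-T : ℝ) : ℂ) * I).im| = T :=
    fun t _ ↦ him_T t _ (Or.inl rfl)
  have htop : ∀ t ∈ Icc a b, |((t : ℂ) + (T : ℂ) * I).im| = T :=
    fun t _ ↦ him_T t _ (Or.inr rfl)
  have h1 : Literature.Analysis.Complex.rectBoundaryIntegral
      (fun s ↦ (-deriv riemannZeta s / riemannZeta s) * Φ s) a b (-T) T =
      Literature.Analysis.Complex.rectBoundaryIntegral (fun s ↦ F₁ s + F₂ s) a b (-T) T :=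
    Literature.Analysis.Complex.rectBoundaryIntegral_congr (G := fun s ↦ F₁ s + F₂ s) hab.le
      (by linarith)
      (fun t ht ↦ integrand_eq_split (hbdry _ (Or.inl (hbot t ht))).2.1 (hbdry _ (Or.inl (hbot t ht))).1)
      (fun t ht ↦ integrand_eq_split (hbdry _ (Or.inl (htop t ht))).2.1 (hbdry _ (Or.inl (htop t ht))).1)
      (fun y _ ↦ integrand_eq_split (hbdry _ (Or.inr (hre_v a (Or.inr rfl) y))).2.1
        (hbdry _ (Or.inr (hre_v a (Or.inr rfl) y))).1)
      (fun y _ ↦ integrand_eq_split (hbdry _ (Or.inr (hre_v b (Or.inl rfl) y))).2.1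
        (hbdry _ (Or.inr (hre_v b (Or.inl rfl) y))).1)
  have h2 : Literature.Analysis.Complex.rectBoundaryIntegral (fun s ↦ F₁ s + F₂ s) a b (-T) T =
      Literature.Analysis.Complex.rectBoundaryIntegral F₁ a b (-T) T +
        Literature.Analysis.Complex.rectBoundaryIntegral F₂ a b (-T) T :=
    Literature.Analysis.Complex.rectBoundaryIntegral_add (F := F₁) (G := F₂) hab.le (by linarith)
      (fun t ht ↦ hcF₁ _ (hbdry _ (Or.inl (hbot t ht))).2.2)
      (fun t ht ↦ hcF₁ _ (hbdry _ (Or.inl (htop t ht))).2.2)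
      (fun y _ ↦ hcF₁ _ (hbdry _ (Or.inr (hre_v a (Or.inr rfl) y))).2.2)
      (fun y _ ↦ hcF₁ _ (hbdry _ (Or.inr (hre_v b (Or.inl rfl) y))).2.2)
      (fun t ht ↦ hcF₂ _ (hbdry _ (Or.inl (hbot t ht))).2.1)
      (fun t ht ↦ hcF₂ _ (hbdry _ (Or.inl (htop t ht))).2.1)
      (fun y _ ↦ hcF₂ _ (hbdry _ (Or.inr (hre_v a (Or.inr rfl) y))).2.1)
      (fun y _ ↦ hcF₂ _ (hbdry _ (Or.inr (hre_v b (Or.inl rfl) y))).2.1)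
  have h1re : a < (1 : ℂ).re := by simp only [Complex.one_re]; linarith
  have h1re' : (1 : ℂ).re < b := by simp only [Complex.one_re]; linarith
  have h1im : -T < (1 : ℂ).im := by simp only [Complex.one_im]; linarith
  have h1im' : (1 : ℂ).im < T := by simp only [Complex.one_im]; linarith
  have h3 : Literature.Analysis.Complex.rectBoundaryIntegral F₂ a b (-T) T = 2 * π * I * 1 * Φ 1 :=
    Literature.Analysis.Complex.rectBoundaryIntegral_const_mul_div_sub (g := Φ) (1 : ℂ) 1
      h1re h1re' h1im h1im' hΦ.differentiableOn
  have h4 : Literature.Analysis.Complex.rectBoundaryIntegral F₁ a b (-T) T =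
      (-1) * Literature.Analysis.Complex.rectBoundaryIntegral
        (fun s ↦ logDeriv riemannZeta₁ s * Φ s) a b (-T) T :=
    Literature.Analysis.Complex.rectBoundaryIntegral_const_mul _ (-1) a b (-T) T
  have h5 := rectBoundaryIntegral_logDeriv_riemannZeta₁_mul hΦ hb hδ hgap hT0 hgood hK
      (fun t ht ↦ (hbdry _ (Or.inl (hbot t ht))).2.2)
      (fun t ht ↦ (hbdry _ (Or.inl (htop t ht))).2.2)
      (fun y _ ↦ (hbdry _ (Or.inr (hre_v a (Or.inr rfl) y))).2.2)
      (fun y _ ↦ (hbdry _ (Or.inr (hre_v b (Or.inl rfl) y))).2.2)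
  rw [← ha] at h5
  rw [h1, h2, h3, h4, h5]
  ring

end LandauGonek

end Literature.NumberTheory.LFunctions

end
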